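import HarnessLib
import Summits.RiemannHypothesis.RiemannHypothesis.Theorems.SignConePointwiseCheckerFar

/-!
# Route SignCone: soundness of the far-range checker (`SignConePointwiseCheckerFar.lean`)

Support for the single-window rungs of `OscSingleWindow` (crux stmt-RiemannHypothesis-18012).
Soundness of the comb-only second-order cells and of the self-marching far cover:

* `PWData.farB_sub_comb_le_F` : `farB w e₀ − C(y) ≤ F_D(y)` for `y ≥ e₀` under the anchor `w`;
* `PWData.farEval_sound`, `PWData.far_cell` : one evaluation certifies a backward piece `[u − γ, u]`
  and a forward piece `[u, u + δ]`;
* `PWData.farMarchTo_sound`, `PWData.farChainOKTo_sound` : the march (version 2, stopping at the next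
  breakpoint) covers `(e, frontier]`, the chain covers `(e₀, lastQ]`; `farChainOKTo_append` glues chains;
* `PWData.chain₂_sound_upTo` : the landed anchored two-point cells up to an arbitrary `Y₁` (no tail);
* `PWData.F_nonneg_of_near_far` : near range `[0, Y₁]` + far range `(Y₁, Y₀]` + tail + evenness
  ⇒ `F_D(y) ≥ 0` for every real `y`.
-/

noncomputable section

-- `Summit.RiemannHypothesis.RiemannHypothesis.…` repeats a namespace component by design (D-0017 layout).
set_option linter.dupNamespace false

open Real

namespace Summit.RiemannHypothesis.RiemannHypothesis.Theorems.SignCone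

open Literature.Analysis.ValidatedNumerics.Numerics Literature.NumberTheory.LFunctions
open Literature.Analysis.SpecialFunctions (reDigammaQuarter reDigammaQuarter_mono reDigammaQuarter_even)

namespace PWData

section Sound

variable {D : PWData}

variable {Y0 : ℚ} (h : D.checkScalars Y0 = true)
include h

/-- **Far lower bound.** For `0 ≤ e₀ ≤ y` and a digamma anchor `w ≤ Re ψ(1/4 + iy/2)`:
`farB w e₀ − C(y) ≤ F_D(y)`. [folklore] -/
theorem farB_sub_comb_le_F {w e0 : ℚ} (he0 : 0 ≤ e0) {y : ℝ} (hy : (e0 : ℝ) ≤ y)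
    (hw : ((w : ℚ) : ℝ) ≤ reDigammaQuarter y) :
    (D.farB w e0 : ℝ) - ∑ n ∈ D.nodeList.toFinset, (D.a n : ℝ) * Real.cos (y * Real.log n) ≤ D.F y := by
  obtain ⟨hL, hh, -, -, -, -, -, -⟩ := check_spec h
  have he0' : (0 : ℝ) ≤ e0 := by exact_mod_cast he0
  have h2 : Real.log π ≤ ((logPiHi : ℚ) : ℝ) := logPiHi_ge
  have hdec := PWKernel.abs_cosTransform_kernelE_le (d := D.d) hL hh y
  have hCE : D.d.decayConst ≤ (D.decayFI.hiQ : ℝ) := FI.le_hiQ (mem_decayFI h)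
  have hC0 := decayConst_nonneg h
  have hD0 : (0 : ℝ) < 1 / 4 + (e0 : ℝ) * e0 := by nlinarith [mul_self_nonneg (e0 : ℝ)]
  have hDy : (1 / 4 : ℝ) + (e0 : ℝ) * e0 ≤ 1 / 4 + y ^ 2 := by nlinarith
  have h3 : |cosTransform D.d.kernelE y| ≤ (D.decayFI.hiQ : ℝ) / (1 / 4 + (e0 : ℝ) * e0) :=
    hdec.trans ((div_le_div_of_nonneg_left hC0 hD0 hDy).trans
      (div_le_div_of_nonneg_right hCE hD0.le))
  have h4 := neg_abs_le (cosTransform D.d.kernelE y)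
  unfold farB F
  push_cast
  linarith

/-- **Soundness of `farEval`** (genuine table): `f ≤ B − C(u)`, `c₁⁻ ≤ C′(u) ≤ c₁⁺`. [folklore] -/
theorem farEval_sound (B u : ℚ) :
    ((D.farEval (FI.logTable D.logN) B u).1 : ℝ) ≤
        B - ∑ n ∈ D.nodeList.toFinset, (D.a n : ℝ) * Real.cos (u * Real.log n) ∧
      ((D.farEval (FI.logTable D.logN) B u).2.1 : ℝ) ≤
        -∑ n ∈ D.nodeList.toFinset, (D.a n : ℝ) * Real.log n * Real.sin (u * Real.log n) ∧
      -∑ n ∈ D.nodeList.toFinset, (D.a n : ℝ) * Real.log n * Real.sin (u * Real.log n) ≤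
        ((D.farEval (FI.logTable D.logN) B u).2.2 : ℝ) := by
  obtain ⟨-, -, hnd, hall, hlog, -, -, -⟩ := check_spec h
  have hm := PW.mem_combCS (a := D.a) hlog (fun n hn => (hall n hn).2.1) u
  rw [← List.sum_toFinset _ hnd, ← List.sum_toFinset _ hnd] at hm
  unfold farEval
  push_cast
  refine ⟨by linarith [FI.le_hiQ hm.1], by linarith [FI.le_hiQ hm.2], by linarith [FI.loQ_le hm.2]⟩

/-- `0 ≤ S₂ := combS2Q` and `Σ a_n log² n ≤ S₂` (genuine table). [folklore] -/
theorem combS2Q_spec :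
    ∑ n ∈ D.nodeList.toFinset, (D.a n : ℝ) * Real.log n ^ 2 ≤
        (PW.combS2Q D.nodeList D.a (FI.logTable D.logN) : ℝ) ∧
      (0 : ℝ) ≤ PW.combS2Q D.nodeList D.a (FI.logTable D.logN) := by
  obtain ⟨-, -, hnd, hall, hlog, -, -, -⟩ := check_spec h
  have h1 := PW.sum_mul_log_sq_le_combS2Q (a := D.a) hlog D.nodeList hall
  rw [← List.sum_toFinset _ hnd] at h1
  refine ⟨h1, le_trans (Finset.sum_nonneg fun n hn => ?_) h1⟩
  have := (hall n (List.mem_toFinset.1 hn)).1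
  have : (0 : ℝ) ≤ D.a n := by exact_mod_cast this
  positivity

omit h in
/-- `farPick` returns a menu width that passes its test. [folklore] -/
theorem farPick_spec {S2 f c1hi δ : ℚ} (hp : farPick S2 f c1hi = some δ) :
    0 ≤ δ ∧ 0 ≤ f - δ * c1hi - δ * δ * S2 / 2 := by
  unfold farPick at hp
  have h1 := List.find?_some hp
  have h2 := List.mem_of_find?_eq_some hp
  rw [decide_eq_true_eq] at h1
  refine ⟨?_, h1⟩
  simp only [farWidths, List.mem_cons, List.mem_nil_iff, or_false] at h2
  rcases h2 with rfl | rfl | rfl | rfl | rfl | rfl | rfl | rfl | rfl | rfl | rfl | rfl | rfl | rfl | rfl | rfl | rfl <;>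
    norm_num

/-- **The far cell.** At a point `u` with `(f, c₁⁻, c₁⁺) = farEval B u`: if `0 ≤ f` and
`0 ≤ f − δ c₁⁺ − δ² S₂/2` then `farB − C ≥ 0` on `[u, u + δ]`; if `0 ≤ f` and
`0 ≤ f + γ c₁⁻ − γ² S₂/2` then `farB − C ≥ 0` on `[u − γ, u]`. [folklore] -/
theorem far_cell (B u : ℚ) {y : ℝ}
    (hcase : (∃ δ : ℚ, 0 ≤ (D.farEval (FI.logTable D.logN) B u).1 ∧
        0 ≤ (D.farEval (FI.logTable D.logN) B u).1 - δ * (D.farEval (FI.logTable D.logN) B u).2.2 -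
          δ * δ * PW.combS2Q D.nodeList D.a (FI.logTable D.logN) / 2 ∧
        (u : ℝ) ≤ y ∧ y ≤ (u : ℝ) + δ) ∨
      (∃ γ : ℚ, 0 ≤ (D.farEval (FI.logTable D.logN) B u).1 ∧
        0 ≤ (D.farEval (FI.logTable D.logN) B u).1 + γ * (D.farEval (FI.logTable D.logN) B u).2.1 -
          γ * γ * PW.combS2Q D.nodeList D.a (FI.logTable D.logN) / 2 ∧
        (u : ℝ) - γ ≤ y ∧ y ≤ u)) :
    0 ≤ (B : ℝ) - ∑ n ∈ D.nodeList.toFinset, (D.a n : ℝ) * Real.cos (y * Real.log n) := by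
  obtain ⟨-, -, hnd, hall, -, -, -, -⟩ := check_spec h
  obtain ⟨hf, hc1, hc2⟩ := farEval_sound h B u
  obtain ⟨hS2, hS0⟩ := combS2Q_spec h
  have hSnn : 0 ≤ ∑ n ∈ D.nodeList.toFinset, (D.a n : ℝ) * Real.log n ^ 2 :=
    Finset.sum_nonneg fun n hn => by
      have := (hall n (List.mem_toFinset.1 hn)).1
      have : (0 : ℝ) ≤ D.a n := by exact_mod_cast this
      positivity
  have htay := comb_taylor D.nodeList.toFinset D.a (fun n hn => (hall n (List.mem_toFinset.1 hn)).1) (u : ℝ) y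
  -- real forms of the rational tests
  rcases hcase with ⟨δ, h0, hδ, hy1, hy2⟩ | ⟨γ, h0, hγ, hy1, hy2⟩
  · -- forward: `t = y − u ∈ [0, δ]`, slope bounded by `c₁⁺`, curvature by `S₂`
    have h0' : (0 : ℝ) ≤ ((D.farEval (FI.logTable D.logN) B u).1 : ℝ) := by exact_mod_cast h0
    have hδ' : (0 : ℝ) ≤ ((D.farEval (FI.logTable D.logN) B u).1 : ℝ) -
        (δ : ℝ) * ((D.farEval (FI.logTable D.logN) B u).2.2 : ℝ) -
        (δ : ℝ) * (δ : ℝ) * (PW.combS2Q D.nodeList D.a (FI.logTable D.logN) : ℝ) / 2 := by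
      exact_mod_cast hδ
    have ht0 : 0 ≤ y - u := by linarith
    have hq := quad_nonneg_of_endpoints hS0 h0' hδ' ht0 (by linarith)
    have e1 : (y - u) * (-∑ n ∈ D.nodeList.toFinset, (D.a n : ℝ) * Real.log n * Real.sin (u * Real.log n)) ≤
        (y - u) * ((D.farEval (FI.logTable D.logN) B u).2.2 : ℝ) := mul_le_mul_of_nonneg_left hc2 ht0
    have e2 : (y - u) ^ 2 / 2 * ∑ n ∈ D.nodeList.toFinset, (D.a n : ℝ) * Real.log n ^ 2 ≤
        (y - u) * (y - u) * (PW.combS2Q D.nodeList D.a (FI.logTable D.logN) : ℝ) / 2 := by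
      have : 0 ≤ (y - u) * (y - u) := mul_nonneg ht0 ht0
      rw [sq]
      nlinarith
    linarith
  · -- backward: `t = u − y ∈ [0, γ]`, slope bounded through `c₁⁻`
    have h0' : (0 : ℝ) ≤ ((D.farEval (FI.logTable D.logN) B u).1 : ℝ) := by exact_mod_cast h0
    have hγ' : (0 : ℝ) ≤ ((D.farEval (FI.logTable D.logN) B u).1 : ℝ) -
        (γ : ℝ) * (-((D.farEval (FI.logTable D.logN) B u).2.1 : ℝ)) -
        (γ : ℝ) * (γ : ℝ) * (PW.combS2Q D.nodeList D.a (FI.logTable D.logN) : ℝ) / 2 := by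
      have : (0 : ℝ) ≤ ((D.farEval (FI.logTable D.logN) B u).1 : ℝ) +
          (γ : ℝ) * ((D.farEval (FI.logTable D.logN) B u).2.1 : ℝ) -
          (γ : ℝ) * (γ : ℝ) * (PW.combS2Q D.nodeList D.a (FI.logTable D.logN) : ℝ) / 2 := by
        exact_mod_cast hγ
      linarith
    have ht0 : 0 ≤ (u : ℝ) - y := by linarith
    have hq := quad_nonneg_of_endpoints hS0 h0' hγ' ht0 (by linarith)
    have e1 : ((u : ℝ) - y) * (∑ n ∈ D.nodeList.toFinset, (D.a n : ℝ) * Real.log n * Real.sin (u * Real.log n)) ≤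
        ((u : ℝ) - y) * (-((D.farEval (FI.logTable D.logN) B u).2.1 : ℝ)) :=
      mul_le_mul_of_nonneg_left (by linarith) ht0
    have e2 : (y - u) ^ 2 / 2 * ∑ n ∈ D.nodeList.toFinset, (D.a n : ℝ) * Real.log n ^ 2 ≤
        ((u : ℝ) - y) * ((u : ℝ) - y) * (PW.combS2Q D.nodeList D.a (FI.logTable D.logN) : ℝ) / 2 := by
      have : 0 ≤ ((u : ℝ) - y) * ((u : ℝ) - y) := mul_nonneg ht0 ht0
      have hsq : (y - u) ^ 2 = ((u : ℝ) - y) * ((u : ℝ) - y) := by ring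
      rw [hsq]
      nlinarith
    nlinarith

/-- **Soundness of the far march.** With a genuine table, an anchor `w ≤ Re ψ(1/4+iy/2)` for all
`y ≥ e₀ ≥ 0` and `0 ≤ γ`: the march from `e ≥ e₀` reaches `≥ e` and covers the half-open
interval `(e, farMarchTo … e]`. [folklore] -/
theorem farMarchTo_sound {w e0 γ : ℚ} (he0 : 0 ≤ e0) (hγ : 0 ≤ γ)
    (hw : ∀ y : ℝ, (e0 : ℝ) ≤ y → ((w : ℚ) : ℝ) ≤ reDigammaQuarter y) (stop : ℚ) :
    ∀ (fuel : ℕ) (e : ℚ), e0 ≤ e →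
      e ≤ D.farMarchTo (FI.logTable D.logN) (PW.combS2Q D.nodeList D.a (FI.logTable D.logN)) (D.farB w e0) γ stop fuel e ∧
      ∀ y : ℝ, (e : ℝ) < y →
        y ≤ D.farMarchTo (FI.logTable D.logN) (PW.combS2Q D.nodeList D.a (FI.logTable D.logN)) (D.farB w e0) γ stop fuel e →
        0 ≤ D.F y
  | 0, e, _ => ⟨le_rfl, fun y h1 h2 => by
      simp only [farMarchTo] at h2
      exact absurd h2 (not_le.2 h1)⟩
  | fuel + 1, e, hee => by
    have hee' : ((e0 : ℚ) : ℝ) ≤ e := by exact_mod_cast hee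
    have hγ' : (0 : ℝ) ≤ γ := by exact_mod_cast hγ
    -- the far lower bound at any `y ≥ e`
    have hFB : ∀ y : ℝ, (e : ℝ) ≤ y →
        (D.farB w e0 : ℝ) - ∑ n ∈ D.nodeList.toFinset, (D.a n : ℝ) * Real.cos (y * Real.log n) ≤ D.F y :=
      fun y hy => farB_sub_comb_le_F h he0 (hee'.trans hy) (hw y (hee'.trans hy))
    simp only [farMarchTo]
    split_ifs with hstop hc hc'
    · exact ⟨le_rfl, fun y h1 h2 => absurd h2 (not_le.2 h1)⟩
    · -- evaluated at `u = e + γ`; backward piece `[e, u]` certified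
      split
      · rename_i δ hδ
        obtain ⟨hδ0, hδok⟩ := farPick_spec hδ
        have ih := farMarchTo_sound he0 hγ hw stop fuel (e + γ + δ) (by linarith)
        refine ⟨by linarith [ih.1], fun y hy1 hy2 => ?_⟩
        rcases le_or_gt y ((e + γ + δ : ℚ) : ℝ) with hyc | hyc
        · refine le_trans ?_ (hFB y hy1.le)
          rcases le_or_gt y ((e + γ : ℚ) : ℝ) with hyu | hyu
          · exact far_cell h _ (e + γ) (Or.inr ⟨γ, hc.1, hc.2, by push_cast; linarith, hyu⟩)
          · exact far_cell h _ (e + γ) (Or.inl ⟨δ, hc.1, hδok, hyu.le, by push_cast at hyc ⊢; linarith⟩)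
        · exact ih.2 y hyc hy2
      · refine ⟨by linarith, fun y hy1 hy2 => ?_⟩
        refine le_trans ?_ (hFB y hy1.le)
        exact far_cell h _ (e + γ) (Or.inr ⟨γ, hc.1, hc.2, by push_cast; linarith, hy2⟩)
    · -- fallback: forward piece from `e`
      split
      · rename_i δ hδ
        obtain ⟨hδ0, hδok⟩ := farPick_spec hδ
        have ih := farMarchTo_sound he0 hγ hw stop fuel (e + δ) (by linarith)
        refine ⟨by linarith [ih.1], fun y hy1 hy2 => ?_⟩
        rcases le_or_gt y ((e + δ : ℚ) : ℝ) with hyc | hyc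
        · refine le_trans ?_ (hFB y hy1.le)
          exact far_cell h _ e (Or.inl ⟨δ, hc', hδok, hy1.le, by push_cast at hyc ⊢; linarith⟩)
        · exact ih.2 y hyc hy2
      · exact ⟨le_rfl, fun y h1 h2 => absurd h2 (not_le.2 h1)⟩
    · exact ⟨le_rfl, fun y h1 h2 => absurd h2 (not_le.2 h1)⟩

/-- **Soundness of the far chain**: a passing chain with increasing breakpoints starting at
`e₀ ≥ 0` covers `(e₀, lastQ]`. [folklore] -/
theorem farChainOKTo_sound {γ : ℚ} (hγ : 0 ≤ γ) (fuel : ℕ) :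
    ∀ (bps : List ℚ) (e0 : ℚ), bps.head? = some e0 → 0 ≤ e0 →
      D.farChainOKTo (FI.logTable D.logN) γ fuel bps = true →
      ∀ y : ℝ, (e0 : ℝ) < y → y ≤ lastQ bps → 0 ≤ D.F y
  | [], e0, hh0, _, _, _, _, _ => by simp at hh0
  | [e], e0, hh0, _, _, y, h1, h2 => by
    simp only [List.head?_cons, Option.some.injEq] at hh0
    subst hh0
    simp only [lastQ] at h2
    exact absurd h2 (not_le.2 h1)
  | e :: e' :: rest, e0, hh0, he0, hok, y, h1, h2 => by
    simp only [List.head?_cons, Option.some.injEq] at hh0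
    subst hh0
    simp only [farChainOKTo, Bool.and_eq_true, decide_eq_true_eq] at hok
    obtain ⟨⟨hee', hreach⟩, hrest⟩ := hok
    rw [lastQ_cons_cons] at h2
    have he0' : (0 : ℝ) ≤ e := by exact_mod_cast he0
    -- the anchor at `e`
    have hw : ∀ y : ℝ, (e : ℝ) ≤ y → ((wLoQ D.prec e (D.mwAt e) : ℚ) : ℝ) ≤ reDigammaQuarter y :=
      fun y hy => (wLoQ_le _ _ _).trans (reDigammaQuarter_mono (by
        rw [abs_of_nonneg he0', abs_of_nonneg (he0'.trans hy)]; exact hy))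
    rcases le_or_gt y (e' : ℝ) with hy | hy
    · have hm := farMarchTo_sound h he0 hγ hw e' fuel e le_rfl
      exact hm.2 y h1 (hy.trans (by exact_mod_cast hreach))
    · exact farChainOKTo_sound hγ fuel (e' :: rest) e' rfl (he0.trans hee') hrest y hy h2


omit h in
/-- Far chains concatenate at a common breakpoint (so that a long chain can be checked in several
files and assembled). [folklore] -/
theorem farChainOKTo_append {logs : List FI} {γ : ℚ} {fuel : ℕ} :
    ∀ (a : List ℚ) (m : ℚ) (b : List ℚ),
      D.farChainOKTo logs γ fuel (a ++ [m]) = true → D.farChainOKTo logs γ fuel (m :: b) = true →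
      D.farChainOKTo logs γ fuel (a ++ m :: b) = true
  | [], _, _, _, h2 => by simpa using h2
  | [x], m, b, h1, h2 => by
    simp only [List.cons_append, List.nil_append, farChainOKTo, Bool.and_eq_true] at h1 ⊢
    exact ⟨h1.1, h2⟩
  | x :: y :: rest, m, b, h1, h2 => by
    simp only [List.cons_append, farChainOKTo, Bool.and_eq_true] at h1 ⊢
    exact ⟨h1.1, farChainOKTo_append (y :: rest) m b h1.2 h2⟩

/-- **Near chain up to `Y₁`** (the landed anchored two-point cells, without the tail): grids chaining
from `st ≥ 0` to `stop`, all passing, cover `[st, stop]` as soon as `st < stop`. [folklore] -/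
theorem chain₂_sound_upTo {cs : List (FI × FI)} {logs : List FI} (ht : D.tablesOK cs logs = true) :
    ∀ (gs : List (ℚ × List ℚ)) (st stop : ℚ), 0 ≤ st → chainOK (gs.map Prod.snd) st stop = true →
      (∀ g ∈ gs, D.checkAGrid₂ cs logs g = true) →
      st ≤ stop ∧ ∀ y : ℝ, (st : ℝ) ≤ y → y ≤ stop → st < stop → 0 ≤ D.F y
  | [], st, stop, _, hch, _ => by
    simp only [List.map_nil, chainOK, decide_eq_true_eq] at hch
    subst hch
    exact ⟨le_rfl, fun y _ _ hlt => absurd hlt (lt_irrefl _)⟩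
  | (w, pts) :: rest, st, stop, hst, hch, hgs => by
    simp only [List.map_cons, chainOK, Bool.and_eq_true, decide_eq_true_eq] at hch
    obtain ⟨hhead, hrest⟩ := hch
    have hg : D.checkAGrid₂ cs logs (w, pts) = true := hgs (w, pts) (by simp)
    have hgs' : ∀ g' ∈ rest, D.checkAGrid₂ cs logs g' = true := fun g' hg' => hgs g' (by simp [hg'])
    match pts, hhead, hg with
    | [], hhead, _ => simp at hhead
    | [x], hhead, _ =>
      simp only [List.head?_cons, Option.some.injEq] at hhead
      subst hhead
      have ih := chain₂_sound_upTo ht rest (lastQ [x]) stop (by simpa [lastQ] using hst) hrest hgs'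
      simp only [lastQ] at ih
      exact ih
    | u :: v :: r, hhead, hg =>
      simp only [List.head?_cons, Option.some.injEq] at hhead
      subst hhead
      have hgr := agrid₂_sound h ht hst hg
      have ih := chain₂_sound_upTo ht rest (lastQ (u :: v :: r)) stop (hst.trans hgr.1) hrest hgs'
      refine ⟨hgr.1.trans ih.1, fun y h1 h2 _ => ?_⟩
      rcases le_or_gt y (lastQ (u :: v :: r) : ℝ) with hy | hy
      · exact hgr.2 y h1 hy
      · exact ih.2 y hy.le h2 (by exact_mod_cast hy.trans_le h2)

/-- **Soundness of the near + far pointwise checker.** If the scalar checks pass for `Y₀`, the tables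
check, anchored two-point grids chain from `0` to `Y₁ > 0` and pass, and a far chain with increasing
breakpoints from `Y₁` to `Y₀` passes, then `F_D(y) ≥ 0` for every real `y`. [folklore] -/
theorem F_nonneg_of_near_far {cs : List (FI × FI)} {logs : List FI} (ht : D.tablesOK cs logs = true)
    (gs : List (ℚ × List ℚ)) {Y1 : ℚ} (hY1 : 0 < Y1) (hY10 : Y1 ≤ Y0)
    (hch : chainOK (gs.map Prod.snd) 0 Y1 = true) (hgs : ∀ g ∈ gs, D.checkAGrid₂ cs logs g = true)
    {γ : ℚ} (hγ : 0 ≤ γ) {fuel : ℕ} (bps : List ℚ) (hhead : bps.head? = some Y1)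
    (hlast : lastQ bps = Y0) (hfar : D.farChainOKTo logs γ fuel bps = true) (y : ℝ) : 0 ≤ D.F y := by
  have hlogs : logs = FI.logTable D.logN := by
    unfold tablesOK at ht
    rw [Bool.and_eq_true, decide_eq_true_eq, decide_eq_true_eq] at ht
    exact ht.2
  wlog hy : 0 ≤ y generalizing y with H
  · have := H (-y) (by linarith); rwa [F_neg] at this
  rcases le_or_gt y (Y1 : ℝ) with hy1 | hy1
  · exact (chain₂_sound_upTo h ht gs 0 Y1 le_rfl hch hgs).2 y (by exact_mod_cast hy) hy1 hY1
  rcases le_or_gt y (Y0 : ℝ) with hy0 | hy0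
  · rw [hlogs] at hfar
    have := farChainOKTo_sound h hγ fuel bps Y1 hhead hY1.le hfar y hy1 (by rw [hlast]; exact hy0)
    exact this
  · exact tail_sound h (hY1.le.trans hY10) y hy0.le

end Sound

/-- The empty far chain passes (registered anchor of this file). [folklore] -/
theorem farChainOKTo_nil : ∀ (D : PWData) (logs : List FI) (γ : ℚ) (fuel : ℕ), D.farChainOKTo logs γ fuel [] = true :=
  fun _ _ _ _ => rfl

end PWData

end Summit.RiemannHypothesis.RiemannHypothesis.Theorems.SignCone

end
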